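import Literature.NumberTheory.EllipticCurves.ComplexMultiplicationSingularModuliProofs
import Literature.NumberTheory.EllipticCurves.ComplexMultiplicationSingularModuliNonmaximal
import HarnessLib

/-!
# The class polynomials of the thirteen class-number-one discriminants: `H_D(X) = X − j(𝒪_D)`,
# and their values at `0` and `1728` (Cox, *Primes of the form x² + ny²*, §12.C (12.20), §13.A)

Topic `NumberTheory/EllipticCurves` (singular moduli); theorem-only file (no definition, no named fact,
D-0026). For each of the thirteen negative discriminants of class number one,
`D ∈ {−3, −4, −7, −8, −11, −12, −16, −19, −27, −28, −43, −67, −163}` (`classNumberOneDiscrs`, Cox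
Thm. 7.30), the tree's **class polynomial** `classPolynomial D = ∏_{Q reduced} (X − j(τ_Q))`
(`ComplexMultiplicationJInvariantProofs.lean`, Cox Prop. 13.2) is the linear polynomial
`X − j(𝒪_D)` with the tabulated rational singular modulus `singularModulus D` (Cox §12.C table
(12.20); §13.A prints the example `H_{−12}(X) = X − j(√−3) = X − 54000`, obtained there from
`Φ₃(X, X) = −X(X − 54000)(X − 8000)²(X + 32768)²`), now that both table facts
are theorems of the tree (`singularModuli_classNumberOne_holds`, `singularModuli_nonmaximalOrders_holds`):

* `classPolynomial_of_mem_classNumberOneDiscrs` — `H_D(X) = X − C(singularModulus D)` for the 13 `D`;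
  `eval_classPolynomial_of_mem_classNumberOneDiscrs` — `H_D(x) = x − j(𝒪_D)`;
* the thirteen explicit polynomials `classPolynomial_neg_three : classPolynomial (-3) = X − C 0`, …,
  `classPolynomial_neg_oneSixtyThree : classPolynomial (-163) = X − C (−262537412640768000)`;
* the values `H_D(1728) = 1728 − j(𝒪_D)` and `H_D(0) = −j(𝒪_D)` in factored form
  (`classPolynomial_eval_1728_neg_<d>`, `classPolynomial_eval_zero_neg_<d>`), e.g.
  `H_{−8}(1728) = −2·56²`, `H_{−28}(1728) = −7·1539²`, `H_{−7}(1728) = 7·27²`, `H_{−163}(0) = (640320)³`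
  — the class-number-one rows of the sign / square / cube patterns of `H_D(1728)`, `H_D(0)`
  (Gross–Zagier 1985, Cor. 1.6-type factorisations; here simply evaluated).

These are instances of published tables, kernel-checked; nothing new. (`H_{−3}(1728) = 1728` is
already `classPolynomial_neg_three_eval_1728` of the Hodge-locus census file
`Summits/HodgeConjecture/HodgeLocus/Census/SingularModuliSquareLawOdd.lean`; not restated.)

## References

* [Cox2013] D. A. Cox, *Primes of the form x² + ny²*, 2nd ed., Wiley 2013: §7.D Thm. 7.30 (the
  thirteen discriminants), §12.C table (12.20) and the table for `3 ∣ D` (the singular moduli),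
  §13.A Prop. 13.2 (the class equation).
* [GrossZagier1985SingularModuli] B. H. Gross, D. B. Zagier, *On singular moduli*, J. reine angew.
  Math. 355 (1985), Thm. 1.3 / Cor. 1.6 (prime factorisations of `j − 1728`, `j`).
-/

noncomputable section

namespace Literature.NumberTheory.EllipticCurves

open Polynomial Literature.NumberTheory.QuadraticFields.BinaryQuadraticForm

/-! ### The class polynomial of a class-number-one discriminant -/

/-- The thirteen class-number-one discriminants are negative, `≡ 0, 1 (mod 4)`, and have exactly one
reduced form (`classNumber D = 1`, Cox Thm. 2.13 / Thm. 7.30 — a finite check).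
[cite: Cox2013, §7.D Thm. 7.30] -/
theorem classNumber_eq_one_of_mem_classNumberOneDiscrs' {D : ℤ} (hD : D ∈ classNumberOneDiscrs) :
    D < 0 ∧ (D % 4 = 0 ∨ D % 4 = 1) ∧ classNumber D = 1 := by
  simp only [classNumberOneDiscrs, Finset.mem_insert, Finset.mem_singleton] at hD
  rcases hD with rfl | rfl | rfl | rfl | rfl | rfl | rfl | rfl | rfl | rfl | rfl | rfl | rfl <;>
    exact ⟨by norm_num, by norm_num, by decide +kernel⟩

/-- **`H_D(X) = X − j(𝒪_D)` for the thirteen class-number-one discriminants**, with `j(𝒪_D)` the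
tabulated rational singular modulus `singularModulus D` (Cox §12.C (12.20); Prop. 13.2 with `h = 1`).
[cite: Cox2013, §13.A Prop. 13.2] -/
theorem classPolynomial_of_mem_classNumberOneDiscrs {D : ℤ} (hD : D ∈ classNumberOneDiscrs) :
    classPolynomial D = X - C ((singularModulus D : ℚ) : ℂ) := by
  obtain ⟨hD0, h4, h1⟩ := classNumber_eq_one_of_mem_classNumberOneDiscrs' hD
  rw [classPolynomial_eq_of_classNumber_eq_one hD0 h4 h1, formJ_principalForm hD0 h4,
    j_cmPeriodPair_eq_singularModulus singularModuli_classNumberOne_holds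
      singularModuli_nonmaximalOrders_holds hD]

/-- `H_D(x) = x − j(𝒪_D)` for the thirteen class-number-one discriminants.
[cite: Cox2013, §13.A Prop. 13.2] -/
theorem eval_classPolynomial_of_mem_classNumberOneDiscrs {D : ℤ} (hD : D ∈ classNumberOneDiscrs)
    (x : ℂ) : (classPolynomial D).eval x = x - ((singularModulus D : ℚ) : ℂ) := by
  rw [classPolynomial_of_mem_classNumberOneDiscrs hD, eval_sub, eval_X, eval_C]

/-! ### The thirteen class polynomials -/

/-- `H_{−3}(X) = X − (0)` (`j(𝒪_{−3}) = 0`, Cox §12.C table (12.20)).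
[cite: Cox2013, §12.C table (12.20)] -/
theorem classPolynomial_neg_three : classPolynomial (-3) = X - C (0 : ℂ) := by
  rw [classPolynomial_of_mem_classNumberOneDiscrs (D := -3) (by decide)]
  norm_num [singularModulus]

/-- `H_{−4}(X) = X − (1728)` (`j(𝒪_{−4}) = 1728`, Cox §12.C table (12.20)).
[cite: Cox2013, §12.C table (12.20)] -/
theorem classPolynomial_neg_four : classPolynomial (-4) = X - C (1728 : ℂ) := by
  rw [classPolynomial_of_mem_classNumberOneDiscrs (D := -4) (by decide)]
  norm_num [singularModulus]

/-- `H_{−7}(X) = X − (-3375)` (`j(𝒪_{−7}) = -3375`, Cox §12.C table (12.20)).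
[cite: Cox2013, §12.C table (12.20)] -/
theorem classPolynomial_neg_seven : classPolynomial (-7) = X - C (-3375 : ℂ) := by
  rw [classPolynomial_of_mem_classNumberOneDiscrs (D := -7) (by decide)]
  norm_num [singularModulus]

/-- `H_{−8}(X) = X − (8000)` (`j(𝒪_{−8}) = 8000`, Cox §12.C table (12.20)).
[cite: Cox2013, §12.C table (12.20)] -/
theorem classPolynomial_neg_eight : classPolynomial (-8) = X - C (8000 : ℂ) := by
  rw [classPolynomial_of_mem_classNumberOneDiscrs (D := -8) (by decide)]
  norm_num [singularModulus]

/-- `H_{−11}(X) = X − (-32768)` (`j(𝒪_{−11}) = -32768`, Cox §12.C table (12.20)).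
[cite: Cox2013, §12.C table (12.20)] -/
theorem classPolynomial_neg_eleven : classPolynomial (-11) = X - C (-32768 : ℂ) := by
  rw [classPolynomial_of_mem_classNumberOneDiscrs (D := -11) (by decide)]
  norm_num [singularModulus]

/-- `H_{−12}(X) = X − (54000)` (`j(𝒪_{−12}) = 54000`, Cox §12.C table (12.20); §13.A).
[cite: Cox2013, §12.C table (12.20)] -/
theorem classPolynomial_neg_twelve : classPolynomial (-12) = X - C (54000 : ℂ) := by
  rw [classPolynomial_of_mem_classNumberOneDiscrs (D := -12) (by decide)]
  norm_num [singularModulus]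

/-- `H_{−16}(X) = X − (287496)` (`j(𝒪_{−16}) = 287496`, Cox §12.C table (12.20)).
[cite: Cox2013, §12.C table (12.20)] -/
theorem classPolynomial_neg_sixteen : classPolynomial (-16) = X - C (287496 : ℂ) := by
  rw [classPolynomial_of_mem_classNumberOneDiscrs (D := -16) (by decide)]
  norm_num [singularModulus]

/-- `H_{−19}(X) = X − (-884736)` (`j(𝒪_{−19}) = -884736`, Cox §12.C table (12.20)).
[cite: Cox2013, §12.C table (12.20)] -/
theorem classPolynomial_neg_nineteen : classPolynomial (-19) = X - C (-884736 : ℂ) := by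
  rw [classPolynomial_of_mem_classNumberOneDiscrs (D := -19) (by decide)]
  norm_num [singularModulus]

/-- `H_{−27}(X) = X − (-12288000)` (`j(𝒪_{−27}) = -12288000`, Cox §12.C table (12.20)).
[cite: Cox2013, §12.C table (12.20)] -/
theorem classPolynomial_neg_twentySeven : classPolynomial (-27) = X - C (-12288000 : ℂ) := by
  rw [classPolynomial_of_mem_classNumberOneDiscrs (D := -27) (by decide)]
  norm_num [singularModulus]

/-- `H_{−28}(X) = X − (16581375)` (`j(𝒪_{−28}) = 16581375`, Cox §12.C table (12.20)).
[cite: Cox2013, §12.C table (12.20)] -/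
theorem classPolynomial_neg_twentyEight : classPolynomial (-28) = X - C (16581375 : ℂ) := by
  rw [classPolynomial_of_mem_classNumberOneDiscrs (D := -28) (by decide)]
  norm_num [singularModulus]

/-- `H_{−43}(X) = X − (-884736000)` (`j(𝒪_{−43}) = -884736000`, Cox §12.C table (12.20)).
[cite: Cox2013, §12.C table (12.20)] -/
theorem classPolynomial_neg_fortyThree : classPolynomial (-43) = X - C (-884736000 : ℂ) := by
  rw [classPolynomial_of_mem_classNumberOneDiscrs (D := -43) (by decide)]
  norm_num [singularModulus]

/-- `H_{−67}(X) = X − (-147197952000)` (`j(𝒪_{−67}) = -147197952000`, Cox §12.C table (12.20)).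
[cite: Cox2013, §12.C table (12.20)] -/
theorem classPolynomial_neg_sixtySeven : classPolynomial (-67) = X - C (-147197952000 : ℂ) := by
  rw [classPolynomial_of_mem_classNumberOneDiscrs (D := -67) (by decide)]
  norm_num [singularModulus]

/-- `H_{−163}(X) = X − (-262537412640768000)` (`j(𝒪_{−163}) = -262537412640768000`, Cox §12.C table (12.20)).
[cite: Cox2013, §12.C table (12.20)] -/
theorem classPolynomial_neg_oneSixtyThree : classPolynomial (-163) = X - C (-262537412640768000 : ℂ) := by
  rw [classPolynomial_of_mem_classNumberOneDiscrs (D := -163) (by decide)]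
  norm_num [singularModulus]

/-! ### `H_D(1728) = 1728 − j(𝒪_D)` and `H_D(0) = −j(𝒪_D)`, factored -/

/-- `H_{−3}(0) = −(0) = 0`. [cite: Cox2013, §12.C table (12.20)] -/
theorem classPolynomial_eval_zero_neg_three :
    (classPolynomial (-3)).eval 0 = 0 := by
  rw [classPolynomial_neg_three, eval_sub, eval_X, eval_C]
  norm_num

/-- `H_{−4}(1728) = 1728 − (1728) = 0 = 0`.
[cite: Cox2013, §12.C table (12.20)] -/
theorem classPolynomial_eval_1728_neg_four :
    (classPolynomial (-4)).eval 1728 = 0 := by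
  rw [classPolynomial_neg_four, eval_sub, eval_X, eval_C]
  norm_num

/-- `H_{−4}(0) = −(1728) = -(2 ^ 6 * 3 ^ 3)`. [cite: Cox2013, §12.C table (12.20)] -/
theorem classPolynomial_eval_zero_neg_four :
    (classPolynomial (-4)).eval 0 = -(2 ^ 6 * 3 ^ 3) := by
  rw [classPolynomial_neg_four, eval_sub, eval_X, eval_C]
  norm_num

/-- `H_{−7}(1728) = 1728 − (-3375) = 5103 = 3 ^ 6 * 7`.
[cite: Cox2013, §12.C table (12.20)] -/
theorem classPolynomial_eval_1728_neg_seven :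
    (classPolynomial (-7)).eval 1728 = 3 ^ 6 * 7 := by
  rw [classPolynomial_neg_seven, eval_sub, eval_X, eval_C]
  norm_num

/-- `H_{−7}(0) = −(-3375) = 3 ^ 3 * 5 ^ 3`. [cite: Cox2013, §12.C table (12.20)] -/
theorem classPolynomial_eval_zero_neg_seven :
    (classPolynomial (-7)).eval 0 = 3 ^ 3 * 5 ^ 3 := by
  rw [classPolynomial_neg_seven, eval_sub, eval_X, eval_C]
  norm_num

/-- `H_{−8}(1728) = 1728 − (8000) = -6272 = -(2 ^ 7 * 7 ^ 2)`.
[cite: Cox2013, §12.C table (12.20)] -/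
theorem classPolynomial_eval_1728_neg_eight :
    (classPolynomial (-8)).eval 1728 = -(2 ^ 7 * 7 ^ 2) := by
  rw [classPolynomial_neg_eight, eval_sub, eval_X, eval_C]
  norm_num

/-- `H_{−8}(0) = −(8000) = -(2 ^ 6 * 5 ^ 3)`. [cite: Cox2013, §12.C table (12.20)] -/
theorem classPolynomial_eval_zero_neg_eight :
    (classPolynomial (-8)).eval 0 = -(2 ^ 6 * 5 ^ 3) := by
  rw [classPolynomial_neg_eight, eval_sub, eval_X, eval_C]
  norm_num

/-- `H_{−11}(1728) = 1728 − (-32768) = 34496 = 2 ^ 6 * 7 ^ 2 * 11`.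
[cite: Cox2013, §12.C table (12.20)] -/
theorem classPolynomial_eval_1728_neg_eleven :
    (classPolynomial (-11)).eval 1728 = 2 ^ 6 * 7 ^ 2 * 11 := by
  rw [classPolynomial_neg_eleven, eval_sub, eval_X, eval_C]
  norm_num

/-- `H_{−11}(0) = −(-32768) = 2 ^ 15`. [cite: Cox2013, §12.C table (12.20)] -/
theorem classPolynomial_eval_zero_neg_eleven :
    (classPolynomial (-11)).eval 0 = 2 ^ 15 := by
  rw [classPolynomial_neg_eleven, eval_sub, eval_X, eval_C]
  norm_num

/-- `H_{−12}(1728) = 1728 − (54000) = -52272 = -(2 ^ 4 * 3 ^ 3 * 11 ^ 2)`.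
[cite: Cox2013, §12.C table (12.20)] -/
theorem classPolynomial_eval_1728_neg_twelve :
    (classPolynomial (-12)).eval 1728 = -(2 ^ 4 * 3 ^ 3 * 11 ^ 2) := by
  rw [classPolynomial_neg_twelve, eval_sub, eval_X, eval_C]
  norm_num

/-- `H_{−12}(0) = −(54000) = -(2 ^ 4 * 3 ^ 3 * 5 ^ 3)`. [cite: Cox2013, §12.C table (12.20)] -/
theorem classPolynomial_eval_zero_neg_twelve :
    (classPolynomial (-12)).eval 0 = -(2 ^ 4 * 3 ^ 3 * 5 ^ 3) := by
  rw [classPolynomial_neg_twelve, eval_sub, eval_X, eval_C]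
  norm_num

/-- `H_{−16}(1728) = 1728 − (287496) = -285768 = -(2 ^ 3 * 3 ^ 6 * 7 ^ 2)`.
[cite: Cox2013, §12.C table (12.20)] -/
theorem classPolynomial_eval_1728_neg_sixteen :
    (classPolynomial (-16)).eval 1728 = -(2 ^ 3 * 3 ^ 6 * 7 ^ 2) := by
  rw [classPolynomial_neg_sixteen, eval_sub, eval_X, eval_C]
  norm_num

/-- `H_{−16}(0) = −(287496) = -(2 ^ 3 * 3 ^ 3 * 11 ^ 3)`. [cite: Cox2013, §12.C table (12.20)] -/
theorem classPolynomial_eval_zero_neg_sixteen :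
    (classPolynomial (-16)).eval 0 = -(2 ^ 3 * 3 ^ 3 * 11 ^ 3) := by
  rw [classPolynomial_neg_sixteen, eval_sub, eval_X, eval_C]
  norm_num

/-- `H_{−19}(1728) = 1728 − (-884736) = 886464 = 2 ^ 6 * 3 ^ 6 * 19`.
[cite: Cox2013, §12.C table (12.20)] -/
theorem classPolynomial_eval_1728_neg_nineteen :
    (classPolynomial (-19)).eval 1728 = 2 ^ 6 * 3 ^ 6 * 19 := by
  rw [classPolynomial_neg_nineteen, eval_sub, eval_X, eval_C]
  norm_num

/-- `H_{−19}(0) = −(-884736) = 2 ^ 15 * 3 ^ 3`. [cite: Cox2013, §12.C table (12.20)] -/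
theorem classPolynomial_eval_zero_neg_nineteen :
    (classPolynomial (-19)).eval 0 = 2 ^ 15 * 3 ^ 3 := by
  rw [classPolynomial_neg_nineteen, eval_sub, eval_X, eval_C]
  norm_num

/-- `H_{−27}(1728) = 1728 − (-12288000) = 12289728 = 2 ^ 6 * 3 * 11 ^ 2 * 23 ^ 2`.
[cite: Cox2013, §12.C table (12.20)] -/
theorem classPolynomial_eval_1728_neg_twentySeven :
    (classPolynomial (-27)).eval 1728 = 2 ^ 6 * 3 * 11 ^ 2 * 23 ^ 2 := by
  rw [classPolynomial_neg_twentySeven, eval_sub, eval_X, eval_C]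
  norm_num

/-- `H_{−27}(0) = −(-12288000) = 2 ^ 15 * 3 * 5 ^ 3`. [cite: Cox2013, §12.C table (12.20)] -/
theorem classPolynomial_eval_zero_neg_twentySeven :
    (classPolynomial (-27)).eval 0 = 2 ^ 15 * 3 * 5 ^ 3 := by
  rw [classPolynomial_neg_twentySeven, eval_sub, eval_X, eval_C]
  norm_num

/-- `H_{−28}(1728) = 1728 − (16581375) = -16579647 = -(3 ^ 8 * 7 * 19 ^ 2)`.
[cite: Cox2013, §12.C table (12.20)] -/
theorem classPolynomial_eval_1728_neg_twentyEight :
    (classPolynomial (-28)).eval 1728 = -(3 ^ 8 * 7 * 19 ^ 2) := by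
  rw [classPolynomial_neg_twentyEight, eval_sub, eval_X, eval_C]
  norm_num

/-- `H_{−28}(0) = −(16581375) = -(3 ^ 3 * 5 ^ 3 * 17 ^ 3)`. [cite: Cox2013, §12.C table (12.20)] -/
theorem classPolynomial_eval_zero_neg_twentyEight :
    (classPolynomial (-28)).eval 0 = -(3 ^ 3 * 5 ^ 3 * 17 ^ 3) := by
  rw [classPolynomial_neg_twentyEight, eval_sub, eval_X, eval_C]
  norm_num

/-- `H_{−43}(1728) = 1728 − (-884736000) = 884737728 = 2 ^ 6 * 3 ^ 8 * 7 ^ 2 * 43`.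
[cite: Cox2013, §12.C table (12.20)] -/
theorem classPolynomial_eval_1728_neg_fortyThree :
    (classPolynomial (-43)).eval 1728 = 2 ^ 6 * 3 ^ 8 * 7 ^ 2 * 43 := by
  rw [classPolynomial_neg_fortyThree, eval_sub, eval_X, eval_C]
  norm_num

/-- `H_{−43}(0) = −(-884736000) = 2 ^ 18 * 3 ^ 3 * 5 ^ 3`. [cite: Cox2013, §12.C table (12.20)] -/
theorem classPolynomial_eval_zero_neg_fortyThree :
    (classPolynomial (-43)).eval 0 = 2 ^ 18 * 3 ^ 3 * 5 ^ 3 := by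
  rw [classPolynomial_neg_fortyThree, eval_sub, eval_X, eval_C]
  norm_num

/-- `H_{−67}(1728) = 1728 − (-147197952000) = 147197953728 = 2 ^ 6 * 3 ^ 6 * 7 ^ 2 * 31 ^ 2 * 67`.
[cite: Cox2013, §12.C table (12.20)] -/
theorem classPolynomial_eval_1728_neg_sixtySeven :
    (classPolynomial (-67)).eval 1728 = 2 ^ 6 * 3 ^ 6 * 7 ^ 2 * 31 ^ 2 * 67 := by
  rw [classPolynomial_neg_sixtySeven, eval_sub, eval_X, eval_C]
  norm_num

/-- `H_{−67}(0) = −(-147197952000) = 2 ^ 15 * 3 ^ 3 * 5 ^ 3 * 11 ^ 3`. [cite: Cox2013, §12.C table (12.20)] -/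
theorem classPolynomial_eval_zero_neg_sixtySeven :
    (classPolynomial (-67)).eval 0 = 2 ^ 15 * 3 ^ 3 * 5 ^ 3 * 11 ^ 3 := by
  rw [classPolynomial_neg_sixtySeven, eval_sub, eval_X, eval_C]
  norm_num

/-- `H_{−163}(1728) = 1728 − (-262537412640768000) = 262537412640769728 = 2 ^ 6 * 3 ^ 6 * 7 ^ 2 * 11 ^ 2 * 19 ^ 2 * 127 ^ 2 * 163`.
[cite: Cox2013, §12.C table (12.20)] -/
theorem classPolynomial_eval_1728_neg_oneSixtyThree :
    (classPolynomial (-163)).eval 1728 = 2 ^ 6 * 3 ^ 6 * 7 ^ 2 * 11 ^ 2 * 19 ^ 2 * 127 ^ 2 * 163 := by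
  rw [classPolynomial_neg_oneSixtyThree, eval_sub, eval_X, eval_C]
  norm_num

/-- `H_{−163}(0) = −(-262537412640768000) = 2 ^ 18 * 3 ^ 3 * 5 ^ 3 * 23 ^ 3 * 29 ^ 3`. [cite: Cox2013, §12.C table (12.20)] -/
theorem classPolynomial_eval_zero_neg_oneSixtyThree :
    (classPolynomial (-163)).eval 0 = 2 ^ 18 * 3 ^ 3 * 5 ^ 3 * 23 ^ 3 * 29 ^ 3 := by
  rw [classPolynomial_neg_oneSixtyThree, eval_sub, eval_X, eval_C]
  norm_num

end Literature.NumberTheory.EllipticCurves
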